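import Summits.QuantumFields.BalabanUV.T4Continuum.Spine.NE1p.DressedSmallFieldTBoxMixedLetterLocal

/-!
# T⁴ programme, spine estimate NE1′ (node O3b/H2) — THE (1.23) TERM IS AN ANALYTIC FUNCTION OF THE SPECTATOR CONFIGURATIONS: for `E(u; t_□, σ)`
# JOINTLY analytic in a Banach-space parameter `u` (print's configurations `U, J` — TYPE) and the contour variables, W89's full local letter
# `u ↦ ∮dt_□∕t_□² Π∫ds(Δ)∮dσ(Δ)∕(σ(Δ)−s(Δ))²·E(u; …) = Δ_S(∂E(u)∕∂t_□|₀)` is ANALYTIC in `u` on the parameter domain, and (1.24)'s bound is UNIFORM there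

Cell `pub-balaban`, sub-cell `t4`, row NE1′ formalisation crew (`t4/formal/NE1p/LEAVES.md` row W93 ∕ DAG N29zzzzze, BOOKED typer R-T150 journal
l.24340, X-read X235 — own-initiative DICTIONARY follower of the unit's W89 «(1.23) IN FULL ON PRINT's ANALYTICITY DOMAIN» (p242876) under R-T61 (ii)),
unit `b2b-balaban-t4-ne1p-formalise-leaf-08` (gen 13).
ADDITIVE — imports W89 `Spine/NE1p/DressedSmallFieldTBoxMixedLetterLocal` ONLY (`tBoxMixedLetter_eq_mixedDiff_deriv_local`, `norm_tBoxMixedLetter_le`,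
`indicator_mem_pi`; → W76 `mixedDiff_eq_sum_powerset`, W57 `isOpen_polyBall`, W55 `analyticOnNhd_apply`, W39.1 `mixedDiff`∕`μS`∕`wS`∕`σS`∕`mixedDiff_pair`,
the substrate's `w₁`∕`circ`, the template's `polydisc` — BY NAME) + Mathlib (`AnalyticOnNhd.fderiv`, `ContinuousLinearMap.apply`,
`Finset.analyticOnNhd_fun_sum`, `AnalyticOnNhd.congr`).  THEOREMS ONLY + one decided `example`; 0 `def`, 0 `instance`, 0 `def … : Prop`, 0 cite,
0 sorry, 0 `attribute`; nothing upstream restated.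

WHY THIS FILE.  [Balaban1988RGII] p. 7, right after (1.24)∕(1.25): «Before considering such a sum we have to take a common domain of analyticity
for all terms in it. From the results of Sect. I.3 it follows that the term (1.23) is an analytic function of configurations U, J, defined on the
space U^c_{k+1}(□₀, (1 + 2β)α₀, (1 + 2β)α₁, α₀). By the construction it depends on U, J restricted to Y₀ ∪ □₀ = Y, and the conditions outside Y
are unessential», and p. 6: «all the considered functions and operators are analytic functions of the configurations U, J in a domain given by
the conditions I.(i)-(iii) with some α′₀, α′₁, and all the bounds above are uniform on the domain» — LOCI of the audited manuscript (renders pp. 6–7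
read as images), TYPE∕CONTEXT only.  W89 typed (1.23) at ONE configuration.  The dictionary statement behind print's sentence — a double contour
letter of a function JOINTLY analytic in (spectator, contour variables) is analytic in the spectator — is kernel bookkeeping once W76's closed
form reduces the letter to finitely many `t_□`-derivatives of vertex slices:
* §1 **`deriv_slice_eq_fderiv`**, **`analyticOnNhd_deriv_slice`**: for `g : P × ℂ → ℂ` analytic on an open `W × V` and `t₀ ∈ V`, `u ↦ ∂∕∂t|_{t₀} g(u,t)`
  is analytic on `W` (Mathlib: the Fréchet derivative of an analytic map is analytic, `AnalyticOnNhd.fderiv`; evaluation on `(0,1)` is the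
  continuous linear `ContinuousLinearMap.apply`; `AnalyticOnNhd.congr` on the open `W`) — `P` ANY complex normed space;
* §2 plumbing: `analyticOnNhd_cons_left` (`t ↦ t ∷ v`), `analyticOnNhd_section` (`E(u;·)` analytic on the polydisc for `u ∈ W`),
  `analyticOnNhd_vertexSlice` (`(u,t) ↦ E(u; t ∷ 𝟙_T)` analytic on `W × {|t| < R₀}`, W89 `indicator_mem_pi`);
* §3 **`tBoxMixedLetter_eq_spectator`** (W89 at every `u ∈ W`) and **`analyticOnNhd_tBoxMixedLetter_spectator`**: for `W ⊆ P` open and `E` JOINTLY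
  analytic on `W × {|t| < R₀} × Π_j{|σ_j| < R_{j+1}}`, `0 < ρ < R₀`, `1 < r_j < R_{j+1}`: the letter `u ↦ ∫_{θ_□} w₁ ρ (0,θ_□)·(∫ wS r S p·E(u; circ ρ θ_□ ∷
  σ_S p) d(⨂ μS S)) dθ_□` is ANALYTIC on `W`; **`analyticOnNhd_deriv_coupled_spectator`**: so is the first variation of the COUPLED expression
  `u ↦ ∂∕∂t|₀E(u; t ∷ 𝟙_S)` (the left side of W89's expansion);
* §4 **`norm_tBoxMixedLetter_le_spectator`**: (1.24)'s shape `ρ⁻¹·A·e^{−(κ₁−1)·#S}` at every `u ∈ W` under a bound `A` UNIFORM on `W` (HYPOTHESIS of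
  (1.21)∕(I.3.54) TYPE, «uniform on the domain»);
* §5 decided: `E(u; t, z₀, z₁) = u·t·z₀z₁` (`P = ℂ`): the letter at the spectator `u` IS `u` — linear, not constant.

HONEST FRAMING.  [folklore] calculus in Banach spaces (Mathlib's analytic-function API) + the lineage's W89∕W76 BY NAME on OUR dictionary objects;
a DICTIONARY row — the MECHANISM by which (1.23) inherits analyticity in the configurations from its integrand; NOT print's Sect. I.3 (the
analyticity of E(□₀,·), H_k, the minimisers in (U, J) is the HYPOTHESIS `hE` here, TYPE READING: `P` ↔ the configuration space, `W` ↔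
U^c_{k+1}(□₀, (1+2β)α₀, (1+2β)α₁, α₀), `E(u;·)` ↔ E(□₀,(tζ̃_□ + t_□ζ_□)H_k(σ(Y₀),B′)) at configuration u); «depends on U, J restricted to Y» and
the common-domain∕sum-over-terms step are NOT touched; `A` is a HYPOTHESIS; no numeral of [Balaban1988RGII] asserted (k2); (B1) for Bałaban's
(2.14) NOT discharged; (B3) = GAPS G-ne9p2-5 UNPRINTED — NOT discharged, untouched; (B5) untouched; 0 binders instantiated on Bałaban's densities ∕
operators ∕ (2.14) data ∕ `d_k` ∕ minimisers ∕ backgrounds; discharges no wall item; wall v1.8 (T4-DAG v48) does NOT move; R-t4r2-Q2 NOT met thereby;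
NE1′ ⇐ the named binders — NOT proved, NOT printed; spine PROVED 0∕9; count 9 unchanged.  Rung (B)+1 on ONE finite four-torus — NOT infinite volume,
NOT a mass gap, NOT OS on ℝ⁴, NOT Clay.  ABSOLUTE RULE honoured: the quotations are LOCI of the audited manuscript [Balaban1988RGII] (CMP 116 (1988)
1–22, pp. 6–7), TYPE∕CONTEXT only, never hypothesis-free facts; nothing internally minted is cited; [folklore] tags on kernel lemmas only.  HONEST
DEPENDENCY: continuum YM on T⁴ ⇐ BetaPertH ∧ nine spine estimates (0/9 proved); BetaPertH ⇐ (D1) ∧ (D4) ∧ CAP+tail; G-an2-4 gates asym, D1 and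
NE2/3/4.
-/

noncomputable section

namespace Summit.QuantumFields.BalabanUV.T4Continuum.NE1p.DressedSmallFieldTBoxMixedLetterSpectator

open MeasureTheory Metric Set Complex Finset Function
open scoped BigOperators
open Summit.QuantumFields.BalabanUV.T4Continuum.B13TermContours
open Summit.QuantumFields.BalabanUV.T4Continuum.NE1p.DressedSmallFieldMixedLetter
open Summit.QuantumFields.BalabanUV.T4Continuum.NE1p.DressedSmallFieldMixedDerivativeBridge (analyticOnNhd_apply)
open Summit.QuantumFields.BalabanUV.T4Continuum.NE1p.DressedSmallFieldMixedDerivativeLetterLocal (isOpen_polyBall)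
open Summit.QuantumFields.BalabanUV.T4Continuum.NE1p.DressedSmallFieldMixedDifferenceClosedForm (mixedDiff_eq_sum_powerset)
open Summit.QuantumFields.BalabanUV.T4Continuum.NE1p.DressedSmallFieldTBoxMixedLetterLocal
open Literature.MathematicalPhysics.QuantumFieldTheory.Dimock2011to13.PolydiscCauchyBounds (polydisc)

variable {n : ℕ} {P : Type*} [NormedAddCommGroup P] [NormedSpace ℂ P]

/-! ## §1 Calculus: the `t_□`-derivative of a function jointly analytic in (spectator, `t_□`) is analytic in the spectator -/

/-- [folklore] The slice derivative is the Fréchet derivative on the direction `(0, 1)` (Mathlib `HasFDerivAt.comp_hasDerivAt`, `HasDerivAt.prodMk`). -/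
theorem deriv_slice_eq_fderiv (g : P × ℂ → ℂ) (u : P) {t₀ : ℂ} (hg : DifferentiableAt ℂ g (u, t₀)) :
    deriv (fun t : ℂ => g (u, t)) t₀ = fderiv ℂ g (u, t₀) ((0 : P), (1 : ℂ)) := by
  have h1 : HasDerivAt (fun t : ℂ => ((u, t) : P × ℂ)) ((0 : P), (1 : ℂ)) t₀ := (hasDerivAt_const t₀ u).prodMk (hasDerivAt_id t₀)
  exact (hg.hasFDerivAt.comp_hasDerivAt t₀ h1).deriv

/-- **THE SLICE DERIVATIVE IS ANALYTIC IN THE SPECTATOR** [folklore]: for `g : P × ℂ → ℂ` analytic on an open product `W × V` and `t₀ ∈ V`,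
`u ↦ ∂∕∂t|_{t₀} g(u,t)` is analytic on `W` — Mathlib `AnalyticOnNhd.fderiv` (the Fréchet derivative of an analytic map is analytic) composed with
`u ↦ (u,t₀)` and evaluated on `(0,1)` by the continuous linear map `ContinuousLinearMap.apply`, then `AnalyticOnNhd.congr` on the open `W`. -/
theorem analyticOnNhd_deriv_slice {W : Set P} {V : Set ℂ} (hW : IsOpen W) {g : P × ℂ → ℂ} (hg : AnalyticOnNhd ℂ g (W ×ˢ V)) {t₀ : ℂ}
    (ht₀ : t₀ ∈ V) : AnalyticOnNhd ℂ (fun u : P => deriv (fun t : ℂ => g (u, t)) t₀) W := by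
  have hinc : AnalyticOnNhd ℂ (fun u : P => ((u, t₀) : P × ℂ)) W := analyticOnNhd_id.prod analyticOnNhd_const
  have hcomp : AnalyticOnNhd ℂ (fun u : P => fderiv ℂ g (u, t₀)) W := hg.fderiv.comp hinc fun u hu => ⟨hu, ht₀⟩
  have hev : AnalyticOnNhd ℂ (fun u : P => fderiv ℂ g (u, t₀) ((0 : P), (1 : ℂ))) W :=
    ((ContinuousLinearMap.apply ℂ ℂ ((0 : P), (1 : ℂ))).analyticOnNhd _).comp hcomp (mapsTo_univ _ _)
  exact hev.congr hW fun u hu => (deriv_slice_eq_fderiv g u ((hg _ ⟨hu, ht₀⟩).differentiableAt)).symm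

/-! ## §2 Sections and vertex slices of a factor jointly analytic in (spectator, `t_□`, cubes) -/

/-- [folklore] The insertion `t ↦ t ∷ v` of the `t_□`-variable in front of a FIXED cube configuration is jointly analytic (`AnalyticOnNhd.pi`). -/
theorem analyticOnNhd_cons_left (v : Fin n → ℂ) (V : Set ℂ) : AnalyticOnNhd ℂ (fun t : ℂ => (Fin.cons t v : Fin (n + 1) → ℂ)) V := by
  refine AnalyticOnNhd.pi fun i => ?_
  induction i using Fin.cases with
  | zero => simpa using (analyticOnNhd_id : AnalyticOnNhd ℂ (fun t : ℂ => t) V)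
  | succ j => simpa using (analyticOnNhd_const : AnalyticOnNhd ℂ (fun _ : ℂ => v j) V)

/-- [folklore] For `u` in the parameter domain, the section `E u` is analytic on the open polydisc (composition with `z ↦ (u, z)`). -/
theorem analyticOnNhd_section {W : Set P} {R : Fin (n + 1) → ℝ} {E : P → (Fin (n + 1) → ℂ) → ℂ}
    (hE : AnalyticOnNhd ℂ (fun q : P × (Fin (n + 1) → ℂ) => E q.1 q.2) (W ×ˢ Set.univ.pi fun j => ball (0 : ℂ) (R j))) {u : P}
    (hu : u ∈ W) : AnalyticOnNhd ℂ (E u) (Set.univ.pi fun j => ball (0 : ℂ) (R j)) :=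
  hE.comp (analyticOnNhd_const.prod analyticOnNhd_id) fun _ hz => ⟨hu, hz⟩

/-- [folklore] The vertex slice `(u, t) ↦ E(u; t ∷ 𝟙_T)` is jointly analytic on `W × {|t| < R₀}` when the cube radii exceed `1`. -/
theorem analyticOnNhd_vertexSlice {W : Set P} {R : Fin (n + 1) → ℝ} (hR1 : ∀ j : Fin n, 1 < R j.succ) {E : P → (Fin (n + 1) → ℂ) → ℂ}
    (hE : AnalyticOnNhd ℂ (fun q : P × (Fin (n + 1) → ℂ) => E q.1 q.2) (W ×ˢ Set.univ.pi fun j => ball (0 : ℂ) (R j))) (T : Finset (Fin n)) :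
    AnalyticOnNhd ℂ (fun q : P × ℂ => E q.1 (Fin.cons q.2 fun i => if i ∈ T then (1 : ℂ) else 0)) (W ×ˢ ball (0 : ℂ) (R 0)) := by
  refine hE.comp (analyticOnNhd_fst.prod ((analyticOnNhd_cons_left _ _).comp analyticOnNhd_snd (mapsTo_univ _ _))) fun q hq => ⟨hq.1, ?_⟩
  exact Set.mem_univ_pi.2 fun j => by
    induction j using Fin.cases with
    | zero => simpa using hq.2
    | succ i => exact (Set.mem_univ_pi.1 (indicator_mem_pi hR1 T)) i

/-! ## §3 THE (1.23) TERM AS A FUNCTION OF THE SPECTATOR CONFIGURATIONS -/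

/-- **W89 AT EVERY SPECTATOR** [folklore] (W89 `tBoxMixedLetter_eq_mixedDiff_deriv_local` on the section): for `u ∈ W` the full local letter of
`E(u; ·)` is `Δ_S(∂E(u)∕∂t_□|₀)`. -/
theorem tBoxMixedLetter_eq_spectator {W : Set P} {ρ : ℝ} (hρ : 0 < ρ) {r : Fin n → ℝ} {R : Fin (n + 1) → ℝ} (hρR : ρ < R 0)
    (hr : ∀ j, 1 < r j) (hrR : ∀ j : Fin n, r j < R j.succ) (S : Finset (Fin n)) {E : P → (Fin (n + 1) → ℂ) → ℂ}
    (hE : AnalyticOnNhd ℂ (fun q : P × (Fin (n + 1) → ℂ) => E q.1 q.2) (W ×ˢ Set.univ.pi fun j => ball (0 : ℂ) (R j))) {u : P} (hu : u ∈ W) :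
    ∫ θ₀ in Icc 0 (2 * Real.pi), w₁ ρ (0, θ₀) *
        ∫ p, wS r S p * E u (Fin.cons (circ ρ θ₀) (σS r S p)) ∂(Measure.pi (μS S)) =
      mixedDiff n S (fun w => deriv (fun t : ℂ => E u (Fin.cons t w)) 0) :=
  tBoxMixedLetter_eq_mixedDiff_deriv_local hρ hρR hr hrR S (analyticOnNhd_section hE hu)

/-- **THE (1.23) TERM IS AN ANALYTIC FUNCTION OF THE SPECTATOR CONFIGURATIONS** (kernel; W76's closed form `mixedDiff_eq_sum_powerset` turns
`Δ_S(∂E(u)∕∂t_□|₀)` into the finite signed sum of the vertex slice derivatives `∂∕∂t|₀ E(u; t ∷ 𝟙_T)`, each analytic in `u` by §1∕§2; Mathlib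
`Finset.analyticOnNhd_fun_sum`; W89 identifies the sum with the letter on `W` — `AnalyticOnNhd.congr`): for a complex Banach space `P` (the space of
configurations — TYPE), `W ⊆ P` open, `E(u; t_□, σ)` JOINTLY analytic on `W × {|t| < R₀} × Π_j{|σ_j| < R_{j+1}}`, the `t_□`-radius `0 < ρ < R₀` and
contour radii `1 < r_j < R_{j+1}`, the map `u ↦ ∫_{θ_□} w₁ ρ (0,θ_□)·(∫ wS r S p·E(u; circ ρ θ_□ ∷ σ_S p) d(⨂ μS S)) dθ_□` is ANALYTIC on `W` —
[Balaban1988RGII] p. 7 «From the results of Sect. I.3 it follows that the term (1.23) is an analytic function of configurations U, J, defined on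
the space U^c_{k+1}(□₀, (1 + 2β)α₀, (1 + 2β)α₁, α₀)» (TYPE∕CONTEXT: the joint analyticity of the integrand in (U, J; t_□, σ) is the HYPOTHESIS here,
print's «results of Sect. I.3» are NOT reproduced). [folklore] -/
theorem analyticOnNhd_tBoxMixedLetter_spectator {W : Set P} (hW : IsOpen W) {ρ : ℝ} (hρ : 0 < ρ) {r : Fin n → ℝ} {R : Fin (n + 1) → ℝ}
    (hρR : ρ < R 0) (hr : ∀ j, 1 < r j) (hrR : ∀ j : Fin n, r j < R j.succ) (S : Finset (Fin n)) {E : P → (Fin (n + 1) → ℂ) → ℂ}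
    (hE : AnalyticOnNhd ℂ (fun q : P × (Fin (n + 1) → ℂ) => E q.1 q.2) (W ×ˢ Set.univ.pi fun j => ball (0 : ℂ) (R j))) :
    AnalyticOnNhd ℂ (fun u : P => ∫ θ₀ in Icc 0 (2 * Real.pi), w₁ ρ (0, θ₀) *
        ∫ p, wS r S p * E u (Fin.cons (circ ρ θ₀) (σS r S p)) ∂(Measure.pi (μS S))) W := by
  have h1 : ∀ j : Fin n, 1 < R j.succ := fun j => (hr j).trans (hrR j)
  -- the finite signed sum of vertex slice derivatives is analytic in the spectator
  have hsum : AnalyticOnNhd ℂ (fun u : P => ∑ T ∈ S.powerset, (-1 : ℂ) ^ (S.card - T.card) *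
      deriv (fun t : ℂ => E u (Fin.cons t fun i => if i ∈ T then (1 : ℂ) else 0)) 0) W :=
    Finset.analyticOnNhd_fun_sum _ fun T _ => analyticOnNhd_const.mul
      (analyticOnNhd_deriv_slice hW (g := fun q : P × ℂ => E q.1 (Fin.cons q.2 fun i => if i ∈ T then (1 : ℂ) else 0))
        (analyticOnNhd_vertexSlice h1 hE T) (mem_ball_self (hρ.trans hρR)))
  refine hsum.congr hW fun u hu => ?_
  show ∑ T ∈ S.powerset, (-1 : ℂ) ^ (S.card - T.card) * deriv (fun t : ℂ => E u (Fin.cons t fun i => if i ∈ T then (1 : ℂ) else 0)) 0 =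
    ∫ θ₀ in Icc 0 (2 * Real.pi), w₁ ρ (0, θ₀) * ∫ p, wS r S p * E u (Fin.cons (circ ρ θ₀) (σS r S p)) ∂(Measure.pi (μS S))
  rw [tBoxMixedLetter_eq_spectator hρ hρR hr hrR S hE hu, mixedDiff_eq_sum_powerset]

/-- **… AND SO IS THE FIRST VARIATION OF THE COUPLED EXPRESSION** [folklore] (§1∕§2 at `T = S`): `u ↦ ∂∕∂t|₀ E(u; t ∷ 𝟙_S)` is analytic on `W`
— the left side of W89's expansion `deriv_coupled_eq_sum_tBoxMixedLetter` at every spectator. -/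
theorem analyticOnNhd_deriv_coupled_spectator {W : Set P} (hW : IsOpen W) {R : Fin (n + 1) → ℝ} (hR0 : 0 < R 0)
    (h1 : ∀ j : Fin n, 1 < R j.succ) (S : Finset (Fin n)) {E : P → (Fin (n + 1) → ℂ) → ℂ}
    (hE : AnalyticOnNhd ℂ (fun q : P × (Fin (n + 1) → ℂ) => E q.1 q.2) (W ×ˢ Set.univ.pi fun j => ball (0 : ℂ) (R j))) :
    AnalyticOnNhd ℂ (fun u : P => deriv (fun t : ℂ => E u (Fin.cons t fun i => if i ∈ S then (1 : ℂ) else 0)) 0) W :=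
  analyticOnNhd_deriv_slice hW (g := fun q : P × ℂ => E q.1 (Fin.cons q.2 fun i => if i ∈ S then (1 : ℂ) else 0))
    (analyticOnNhd_vertexSlice h1 hE S) (mem_ball_self hR0)

/-! ## §4 (1.24)'s SHAPE, UNIFORM ON THE PARAMETER DOMAIN -/

/-- **(1.24) UNIFORMLY IN THE SPECTATOR** [folklore] (W89 `norm_tBoxMixedLetter_le` on every section): if `‖E(u; t ∷ z)‖ ≤ A` for all `u ∈ W`,
`|t| = ρ`, `|z_j| ≤ e^{κ₁}` (a HYPOTHESIS of (1.21)∕(I.3.54) TYPE, «all the bounds above are uniform on the domain», p. 6 — TYPE), then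
`|(1.23)(u)| ≤ ρ⁻¹·A·e^{−(κ₁−1)·#S}` for every `u ∈ W`. -/
theorem norm_tBoxMixedLetter_le_spectator {W : Set P} {ρ : ℝ} (hρ : 0 < ρ) {r : Fin n → ℝ} {R : Fin (n + 1) → ℝ} (hρR : ρ < R 0)
    (hr : ∀ j, 1 < r j) (hrR : ∀ j : Fin n, r j < R j.succ) {κ₁ A : ℝ} (hκ : 1 ≤ κ₁) (hR : ∀ j : Fin n, Real.exp κ₁ < R j.succ)
    (S : Finset (Fin n)) {E : P → (Fin (n + 1) → ℂ) → ℂ}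
    (hE : AnalyticOnNhd ℂ (fun q : P × (Fin (n + 1) → ℂ) => E q.1 q.2) (W ×ˢ Set.univ.pi fun j => ball (0 : ℂ) (R j)))
    (hA : ∀ u ∈ W, ∀ t : ℂ, ‖t‖ = ρ → ∀ z ∈ polydisc (fun _ : Fin n => Real.exp κ₁), ‖E u (Fin.cons t z)‖ ≤ A) {u : P} (hu : u ∈ W) :
    ‖∫ θ₀ in Icc 0 (2 * Real.pi), w₁ ρ (0, θ₀) *
        ∫ p, wS r S p * E u (Fin.cons (circ ρ θ₀) (σS r S p)) ∂(Measure.pi (μS S))‖ ≤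
      ρ⁻¹ * (A * Real.exp (-((κ₁ - 1) * S.card))) :=
  norm_tBoxMixedLetter_le hρ hρR hr hrR hκ hR S (analyticOnNhd_section hE hu) (hA u hu)

/-! ## §5 Decided check: the spectator enters linearly -/

/-- [folklore] The decided datum `E(u; t, z₀, z₁) = u·t·z₀z₁` (`P = ℂ`) is jointly analytic everywhere. -/
theorem analyticOnNhd_spectator_toy (W : Set ℂ) (R : Fin 3 → ℝ) :
    AnalyticOnNhd ℂ (fun q : ℂ × (Fin 3 → ℂ) => q.1 * q.2 0 * (q.2 (Fin.succ 0) * q.2 (Fin.succ 1)))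
      (W ×ˢ Set.univ.pi fun j => ball (0 : ℂ) (R j)) := by
  have hc : ∀ i : Fin 3, AnalyticOnNhd ℂ (fun q : ℂ × (Fin 3 → ℂ) => q.2 i) (W ×ˢ Set.univ.pi fun j => ball (0 : ℂ) (R j)) := fun i =>
    ((analyticOnNhd_apply (n := 3) i).comp analyticOnNhd_snd (mapsTo_univ _ _))
  exact (analyticOnNhd_fst.mul (hc 0)).mul ((hc _).mul (hc _))

/-- DECIDED CHECK: for `E(u; t, z₀, z₁) = u·t·z₀z₁` on any open `W ⊆ ℂ`, `t_□`-radius `1 < 2`, cube radii `3∕2 < 2`: the letter at the spectator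
`u` IS `Δ_{01}(u·z₀z₁) = u` — visibly analytic (indeed linear) and NOT constant in the spectator. -/
example {W : Set ℂ} {u : ℂ} (hu : u ∈ W) :
    ∫ θ₀ in Icc 0 (2 * Real.pi), w₁ 1 (0, θ₀) *
        ∫ p : Fin 2 → ℝ × ℝ, wS (fun _ => (3 / 2 : ℝ)) {0, 1} p *
          (u * circ 1 θ₀ * (σS (fun _ => (3 / 2 : ℝ)) {0, 1} p 0 * σS (fun _ => (3 / 2 : ℝ)) {0, 1} p 1)) ∂(Measure.pi (μS {0, 1})) = u := by
  have h := tBoxMixedLetter_eq_spectator (n := 2) (W := W) (ρ := 1) one_pos (r := fun _ => 3 / 2) (R := fun _ => 2) (by norm_num)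
    (fun _ => by norm_num) (fun _ => by norm_num) {0, 1} (E := fun u v => u * v 0 * (v (Fin.succ 0) * v (Fin.succ 1)))
    (analyticOnNhd_spectator_toy W _) hu
  simp only [Fin.cons_zero, Fin.cons_succ] at h
  rw [h]
  have hd : ∀ w : Fin 2 → ℂ, HasDerivAt (fun t : ℂ => u * t * (w 0 * w 1)) (u * 1 * (w 0 * w 1)) 0 := fun w =>
    ((hasDerivAt_id (0 : ℂ)).const_mul u).mul_const (w 0 * w 1)
  simp_rw [(hd _).deriv, mixedDiff_pair]
  norm_num

end Summit.QuantumFields.BalabanUV.T4Continuum.NE1p.DressedSmallFieldTBoxMixedLetterSpectator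

end
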